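import Mathlib
import Literature.Analysis.InnerProduct.WeylEigenvalueInequalities
import Summits.ValiantsHypothesis.ValiantsHypothesis.Theorems.KPlusLogSqLawLoewnerInterlacing

/-!
# Route «KPlusLogSqLaw», `WeakLifting` (stmt-ValiantsHypothesis-19561) — the INERTIA LAW for strictly monotone pencils:
# at most `ν₋(constant term)` distinct positive determinant zeros

HONEST FRAMING.  Helper file (seat val-sym-lift-p2 g10, cell `pub-symmetroid`, 2026-08-28; α register of the desk, R2102/R2114,
UPPER side) on the ONE-SIGNED (Loewner) sector of the static definite tridiagonal real row, with the SHARP INERTIA CONSTANT.  The tree's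
Loewner engine (`LoewnerSector.posRoots_le_of_normalisation`, seat val-sym-mdr-p2) bounds the number of distinct positive determinant zeros of a
positively normalisable Loewner-monotone pencil by the SIZE `card ι`; this file proves the refinement by the NEGATIVE INERTIA OF THE CONSTANT
TERM.  ABSTRACT FORM (`MonotoneInertia.card_posRoots_le_card_negEigen`): if `G : ℝ → Matrix ι ι ℝ` is real symmetric, STRICTLY Loewner
increasing on `(0,∞)` (`G t − G s ≻ 0` for `0 < s < t`), and `G s − C' ≻ 0` for all `s > 0` for a fixed symmetric `C'`, then a real polynomial
whose positive roots are determinant zeros of `G` has at most `#{k : λ↓ₖ(C') < 0}` distinct positive roots.  MECHANISM (three lines): each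
`λ↓ₖ(G(s))` is STRICTLY increasing in `s` and exceeds `λ↓ₖ(C')` strictly (dual Weyl inequality of the Literature file + positivity of the smallest
eigenvalue of a positive definite increment: `eigenvalues₀_lt_of_posDef`), and at each positive determinant zero some `λ↓ₖ` vanishes
(`LoewnerInterlacing.exists_eigenvalues₀_eq_zero`); so «zero ↦ vanishing index» is injective into `{k : λ↓ₖ(C') < 0}`.
VERTEX-GAUGE COROLLARY (`card_posRoots_vertexGauge_le`): for `C'` real symmetric, `aᵢ > 0` and exponents `eᵢ ≥ 1`, the polynomial
`det (diagonal (aᵢ X^{eᵢ}) + C')` has at most `ν₋(C')` distinct positive roots.  For a static definite tridiagonal design whose rates, after the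
diagonal monomial congruence that makes the links constant (vertex gauge of lift-p1 g10 / lift-p3 g9, `e^{tE} − J₀`), are all POSITIVE, this is
the design's determinant up to a monomial: `Z ≤ ν₋(−J₀) = π₊(J₀)`, which for the hollow Jacobi matrix of a path is `⌊m/2⌋` (the «Loewner sector
≤ ⌊m/2⌋» row of lift-p3 g8's memo, there a paper remark; the evaluation `π₊(J₀) = ⌊m/2⌋` is NOT typed here) — versus `m` from the size bound,
i.e. the Cameron–Psarrakos one-alternation rule [CameronPsarrakos2019, Lemma 6] with `n` replaced by the inertia of the constant term.  This
inertia count is the real-variable half (step (1)) of the seat's paper theorem on the dominant-minority-speed sector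
(COMPLEX-PAIR-ACCOUNTING-liftp2g10.md).  Nothing here is about `WeakLifting` / `stub_tridiagonalSectorB` in their window, `TropicalB`,
Conjecture B, the Door-A registers, `MatrixDescartes` (stmt-ValiantsHypothesis-18050) or VP ≠ VNP.  Label: calibration (one-signed sector) with
the sharp constant.  No `def`.  [folklore: Weyl monotonicity; HornJohnson2013 Cor. 4.3.3 via the Literature file]
-/

set_option linter.dupNamespace false
set_option autoImplicit false

namespace Summit.ValiantsHypothesis.ValiantsHypothesis.Theorems.KPlusLogSqLaw

open Matrix Finset Polynomial
open scoped BigOperators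

namespace MonotoneInertia

variable {ι : Type} [Fintype ι] [DecidableEq ι]

/-! ## 1. Strict Weyl monotonicity under a positive definite increment -/

/-- **strict Weyl monotonicity**: if `P` is positive definite and `C = A + P` then `λ↓ₖ(A) < λ↓ₖ(C)` for every `k`
(dual Weyl inequality `λ↓ₖ(A) + λ↓_min(P) ≤ λ↓ₖ(A + P)` plus `λ↓_min(P) > 0`). [folklore; HornJohnson2013 Cor. 4.3.3 via the Literature file] -/
theorem eigenvalues₀_lt_of_posDef {A P C : Matrix ι ι ℝ} (hA : A.IsHermitian) (hP : P.PosDef) (hCdef : C = A + P)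
    (hC : C.IsHermitian) (k : Fin (Fintype.card ι)) : hA.eigenvalues₀ k < hC.eigenvalues₀ k := by
  have hcard : 0 < Fintype.card ι := Fin.pos k
  let q : Fin (Fintype.card ι) := ⟨Fintype.card ι - 1, by omega⟩
  have hq : 0 < hP.1.eigenvalues₀ q := by
    have h := hP.eigenvalues_pos ((Fintype.equivOfCardEq (Fintype.card_fin _)) q)
    simpa [Matrix.IsHermitian.eigenvalues] using h
  have h := Literature.Analysis.InnerProduct.add_le_eigenvalues₀_add hA hP.1 hCdef hC k q k
    (by simp only [q]; omega)
  linarith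

/-! ## 2. The inertia law, abstract form -/

/-- **INERTIA LAW (abstract form).**  Let `G : ℝ → Matrix ι ι ℝ` be real symmetric, strictly Loewner increasing on `(0, ∞)`
(`G t − G s ≻ 0` for `0 < s < t`) and strictly above a fixed symmetric `C'` there (`G s − C' ≻ 0` for `s > 0`).  If every positive root of
the real polynomial `P` is a determinant zero of `G`, then `P` has at most `#{k : λ↓ₖ(C') < 0}` distinct positive roots. [folklore] -/
theorem card_posRoots_le_card_negEigen (G : ℝ → Matrix ι ι ℝ) (hG : ∀ s, (G s).IsHermitian)
    (hstrict : ∀ s t : ℝ, 0 < s → s < t → (G t - G s).PosDef)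
    {C' : Matrix ι ι ℝ} (hC' : C'.IsHermitian) (habove : ∀ s : ℝ, 0 < s → (G s - C').PosDef)
    (P : ℝ[X]) (hP : ∀ s : ℝ, 0 < s → P.IsRoot s → (G s).det = 0) :
    (P.roots.toFinset.filter (fun s => 0 < s)).card ≤ (univ.filter (fun k => hC'.eigenvalues₀ k < 0)).card := by
  classical
  set R := P.roots.toFinset.filter (fun s => 0 < s) with hR
  have hRpos : ∀ s ∈ R, 0 < s := fun s hs => (Finset.mem_filter.mp hs).2
  have hRdet : ∀ s ∈ R, (G s).det = 0 := by
    intro s hs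
    obtain ⟨hmem, hpos⟩ := Finset.mem_filter.mp hs
    have hroot : P.IsRoot s := (Polynomial.mem_roots'.mp (Multiset.mem_toFinset.mp hmem)).2
    exact hP s hpos hroot
  by_cases hι : Fintype.card ι = 0
  · -- empty index type: every determinant is `1`, so `R` is empty
    haveI : IsEmpty ι := Fintype.card_eq_zero_iff.mp hι
    have hRe : R = ∅ := by
      refine Finset.eq_empty_of_forall_notMem fun s hs => ?_
      have h := hRdet s hs
      rw [Matrix.det_isEmpty] at h
      exact one_ne_zero h
    rw [hRe, Finset.card_empty]
    exact Nat.zero_le _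
  · have hcard : 0 < Fintype.card ι := Nat.pos_of_ne_zero hι
    -- the vanishing index at each member of `R`
    let f : ℝ → Fin (Fintype.card ι) := fun s =>
      if h : s ∈ R then Classical.choose (LoewnerInterlacing.exists_eigenvalues₀_eq_zero (hG s) (hRdet s h))
      else ⟨0, hcard⟩
    have hf : ∀ s ∈ R, (hG s).eigenvalues₀ (f s) = 0 := by
      intro s hs
      simp only [f, dif_pos hs]
      exact Classical.choose_spec (LoewnerInterlacing.exists_eigenvalues₀_eq_zero (hG s) (hRdet s hs))
    -- strict monotonicity of every sorted eigenvalue along `G`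
    have hmono : ∀ s t : ℝ, 0 < s → s < t → ∀ k, (hG s).eigenvalues₀ k < (hG t).eigenvalues₀ k :=
      fun s t hs hst k => eigenvalues₀_lt_of_posDef (hG s) (hstrict s t hs hst) (by abel) (hG t) k
    -- every sorted eigenvalue of `G s` exceeds the corresponding one of `C'`
    have habv : ∀ s : ℝ, 0 < s → ∀ k, hC'.eigenvalues₀ k < (hG s).eigenvalues₀ k :=
      fun s hs k => eigenvalues₀_lt_of_posDef hC' (habove s hs) (by abel) (hG s) k
    -- `f` maps `R` into the negative indices of `C'`
    have hmaps : ∀ s ∈ R, f s ∈ univ.filter (fun k => hC'.eigenvalues₀ k < 0) := by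
      intro s hs
      refine Finset.mem_filter.mpr ⟨Finset.mem_univ _, ?_⟩
      have h := habv s (hRpos s hs) (f s)
      rwa [hf s hs] at h
    -- `f` is injective on `R`
    have hinj : Set.InjOn f R := by
      intro s₁ hs₁ s₂ hs₂ heq
      by_contra hne
      rcases lt_or_gt_of_ne hne with hlt | hlt
      · have h := hmono s₁ s₂ (hRpos s₁ hs₁) hlt (f s₁)
        rw [hf s₁ hs₁, heq, hf s₂ hs₂] at h
        exact lt_irrefl _ h
      · have h := hmono s₂ s₁ (hRpos s₂ hs₂) hlt (f s₂)
        rw [hf s₂ hs₂, ← heq, hf s₁ hs₁] at h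
        exact lt_irrefl _ h
    exact Finset.card_le_card_of_injOn f hmaps hinj

/-! ## 3. The vertex gauge of a static definite tridiagonal design with one-signed rates -/

/-- evaluation of the vertex-gauge pencil `diagonal (aᵢ X^{eᵢ}) + C'` at a real point. [folklore] -/
theorem eval_det_vertexGauge (a : ι → ℝ) (e : ι → ℕ) (C' : Matrix ι ι ℝ) (s : ℝ) :
    (Matrix.det (Matrix.diagonal (fun i => Polynomial.C (a i) * (X : ℝ[X]) ^ e i) + C'.map Polynomial.C)).eval s
      = Matrix.det (Matrix.diagonal (fun i => a i * s ^ e i) + C') := by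
  have h := RingHom.map_det (Polynomial.evalRingHom s)
    (Matrix.diagonal (fun i => Polynomial.C (a i) * (X : ℝ[X]) ^ e i) + C'.map Polynomial.C)
  rw [Polynomial.coe_evalRingHom] at h
  have hm : (Polynomial.evalRingHom s).mapMatrix
      (Matrix.diagonal (fun i => Polynomial.C (a i) * (X : ℝ[X]) ^ e i) + C'.map Polynomial.C)
        = Matrix.diagonal (fun i => a i * s ^ e i) + C' := by
    ext i j
    simp only [RingHom.mapMatrix_apply, Matrix.map_apply, Matrix.add_apply, Matrix.diagonal_apply,
      Polynomial.coe_evalRingHom]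
    split_ifs <;> simp
  rw [h, hm]

/-- **INERTIA LAW IN THE VERTEX GAUGE (one-signed rates).**  For `C'` real symmetric, positive coefficients `aᵢ` and exponents `eᵢ ≥ 1`,
the polynomial `det (diagonal (aᵢ X^{eᵢ}) + C')` has at most `#{k : λ↓ₖ(C') < 0}` distinct positive roots.  For a static definite
tridiagonal design with one-signed (positive) vertex-gauge rates and `C' = −J₀` (`J₀` the hollow Jacobi matrix of link coefficients) this is
`Z ≤ π₊(J₀)` (= `⌊m/2⌋` for a path; that evaluation is not typed here). [folklore] -/
theorem card_posRoots_vertexGauge_le (a : ι → ℝ) (ha : ∀ i, 0 < a i) (e : ι → ℕ) (he : ∀ i, 1 ≤ e i)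
    (C' : Matrix ι ι ℝ) (hC' : C'.IsHermitian) :
    ((Matrix.det (Matrix.diagonal (fun i => Polynomial.C (a i) * (X : ℝ[X]) ^ e i) + C'.map Polynomial.C)).roots.toFinset.filter
        (fun s => 0 < s)).card ≤ (univ.filter (fun k => hC'.eigenvalues₀ k < 0)).card := by
  let G : ℝ → Matrix ι ι ℝ := fun s => Matrix.diagonal (fun i => a i * s ^ e i) + C'
  have hG : ∀ s, (G s).IsHermitian := fun s => (Matrix.isHermitian_diagonal _).add hC'
  have hstrict : ∀ s t : ℝ, 0 < s → s < t → (G t - G s).PosDef := by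
    intro s t hs hst
    have hsub : G t - G s = Matrix.diagonal (fun i => a i * (t ^ e i - s ^ e i)) := by
      ext i j
      simp only [G, Matrix.sub_apply, Matrix.add_apply, Matrix.diagonal_apply]
      split_ifs <;> ring
    rw [hsub]
    refine Matrix.PosDef.diagonal fun i => mul_pos (ha i) (sub_pos.mpr ?_)
    exact pow_lt_pow_left₀ hst hs.le (Nat.one_le_iff_ne_zero.mp (he i))
  have habove : ∀ s : ℝ, 0 < s → (G s - C').PosDef := by
    intro s hs
    have hsub : G s - C' = Matrix.diagonal (fun i => a i * s ^ e i) := by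
      ext i j
      simp only [G, Matrix.sub_apply, Matrix.add_apply, Matrix.diagonal_apply]
      split_ifs <;> ring
    rw [hsub]
    exact Matrix.PosDef.diagonal fun i => mul_pos (ha i) (pow_pos hs _)
  refine card_posRoots_le_card_negEigen G hG hstrict hC' habove _ fun s hs hroot => ?_
  rw [Polynomial.IsRoot.def, eval_det_vertexGauge] at hroot
  exact hroot

/-! ## 4. Counting negative eigenvalues: an isotropic coordinate block of size `p` leaves at most `|ι| − p` negative eigenvalues -/

/-- all sorted eigenvalues of the zero matrix vanish. [folklore] -/
theorem eigenvalues₀_zero {κ : Type} [Fintype κ] [DecidableEq κ] (h0 : (0 : Matrix κ κ ℝ).IsHermitian)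
    (k : Fin (Fintype.card κ)) : h0.eigenvalues₀ k = 0 := by
  have hall : ∀ i, h0.eigenvalues i = 0 := by
    have hcard : Fintype.card {i // h0.eigenvalues i ≠ 0} = 0 := by
      rw [← h0.rank_eq_card_non_zero_eigs, Matrix.rank_zero]
    intro i
    by_contra hi
    exact (Fintype.card_eq_zero_iff.mp hcard).false ⟨i, hi⟩
  have h := hall ((Fintype.equivOfCardEq (Fintype.card_fin _)) k)
  simpa [Matrix.IsHermitian.eigenvalues] using h

/-- **negative inertia under an isotropic coordinate block**: if the principal submatrix of a real symmetric `A` on the image of an injective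
`f : κ → ι` vanishes, then at most `|ι| − |κ|` sorted eigenvalues of `A` are negative (Cauchy interlacing against the zero compression).
[folklore; HornJohnson2013 Thm. 4.3.28 via the Literature file] -/
theorem card_negEigen_le_of_submatrix_eq_zero {κ : Type} [Fintype κ] [DecidableEq κ] {A : Matrix ι ι ℝ} (hA : A.IsHermitian)
    (f : κ → ι) (hf : Function.Injective f) (h0 : A.submatrix f f = 0) :
    (univ.filter (fun k => hA.eigenvalues₀ k < 0)).card ≤ Fintype.card ι - Fintype.card κ := by
  classical
  have hle : Fintype.card κ ≤ Fintype.card ι := Fintype.card_le_of_injective f hf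
  -- the first `|κ|` sorted eigenvalues of `A` are `≥ 0`
  have hnonneg : ∀ k : Fin (Fintype.card ι), (k : ℕ) < Fintype.card κ → 0 ≤ hA.eigenvalues₀ k := by
    intro k hk
    have hB : (A.submatrix f f).IsHermitian := hA.submatrix f
    have h := Literature.Analysis.InnerProduct.eigenvalues₀_submatrix_le hA f hf hB ⟨k, hk⟩ k le_rfl
    have hz : hB.eigenvalues₀ ⟨k, hk⟩ = 0 := by
      have h0' : (0 : Matrix κ κ ℝ).IsHermitian := Matrix.isHermitian_zero
      have : hB.eigenvalues₀ = h0'.eigenvalues₀ := by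
        congr 1
      rw [this]
      exact eigenvalues₀_zero h0' _
    rw [hz] at h
    exact h
  -- so the negative indices avoid the image of `Fin |κ|`
  set S := univ.filter (fun k => hA.eigenvalues₀ k < 0) with hS
  set T : Finset (Fin (Fintype.card ι)) := univ.image (Fin.castLE hle) with hT
  have hTcard : T.card = Fintype.card κ := by
    rw [hT, Finset.card_image_of_injective _ (Fin.castLE_injective hle), Finset.card_univ, Fintype.card_fin]
  have hdisj : Disjoint S T := by
    rw [Finset.disjoint_left]
    intro k hkS hkT
    obtain ⟨j, -, rfl⟩ := Finset.mem_image.mp hkT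
    have h1 : hA.eigenvalues₀ (Fin.castLE hle j) < 0 := (Finset.mem_filter.mp hkS).2
    have h2 : 0 ≤ hA.eigenvalues₀ (Fin.castLE hle j) := hnonneg _ (by simp)
    exact absurd h1 (not_lt.mpr h2)
  have hsum : S.card + T.card ≤ Fintype.card ι := by
    rw [← Finset.card_union_of_disjoint hdisj]
    exact (Finset.card_le_univ _).trans (by rw [Fintype.card_fin])
  omega

/-- **parity-bipartite hollow matrices** (e.g. the hollow Jacobi matrix of a path, or its negative): if `C' i j = 0` whenever `i + j` is even,
then at most `⌊m/2⌋` sorted eigenvalues of `C'` are negative (the even-indexed coordinates span an isotropic block of size `⌈m/2⌉`). [folklore] -/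
theorem card_negEigen_le_half {m : ℕ} {C' : Matrix (Fin m) (Fin m) ℝ} (hC' : C'.IsHermitian)
    (hpar : ∀ i j : Fin m, Even ((i : ℕ) + j) → C' i j = 0) :
    (univ.filter (fun k => hC'.eigenvalues₀ k < 0)).card ≤ m / 2 := by
  -- the even coordinates `2 j`, `j < ⌈m/2⌉ = m − m/2`
  let f : Fin (m - m / 2) → Fin m := fun j => ⟨2 * (j : ℕ), by have := j.2; omega⟩
  have hf : Function.Injective f := by
    intro j j' h
    have h' : 2 * (j : ℕ) = 2 * (j' : ℕ) := by
      have := congr_arg (fun x : Fin m => (x : ℕ)) h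
      simpa [f] using this
    exact Fin.ext (by omega)
  have h0 : C'.submatrix f f = 0 := by
    ext j j'
    simp only [Matrix.submatrix_apply, Matrix.zero_apply]
    exact hpar _ _ ⟨(j : ℕ) + j', by simp [f]; ring⟩
  have h := card_negEigen_le_of_submatrix_eq_zero hC' f hf h0
  simp only [Fintype.card_fin] at h
  omega

/-- **ONE-SIGNED VERTEX-GAUGE SECTOR OF THE STATIC DEFINITE TRIDIAGONAL ROW: `Z ≤ ⌊m/2⌋` (all `m`).**  For positive coefficients `aᵢ`,
exponents `eᵢ ≥ 1` and a real symmetric `C'` vanishing at all entries `(i, j)` with `i + j` even (hollow tridiagonal matrices qualify), the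
polynomial `det (diagonal (aᵢ X^{eᵢ}) + C')` has at most `⌊m/2⌋` distinct positive roots.  This is the real symmetric tridiagonal monomial
pencil `diag(aᵢ x^{eᵢ}) − J₀` with constant links and increasing diagonal — the vertex gauge of a static definite tridiagonal design whose gauge
rates are all positive — and the bound is sharp (`m/2` links switched on one at a time).  [folklore: Weyl monotonicity + Cauchy interlacing] -/
theorem card_posRoots_vertexGauge_le_half {m : ℕ} (a : Fin m → ℝ) (ha : ∀ i, 0 < a i) (e : Fin m → ℕ) (he : ∀ i, 1 ≤ e i)
    (C' : Matrix (Fin m) (Fin m) ℝ) (hC' : C'.IsHermitian) (hpar : ∀ i j : Fin m, Even ((i : ℕ) + j) → C' i j = 0) :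
    ((Matrix.det (Matrix.diagonal (fun i => Polynomial.C (a i) * (X : ℝ[X]) ^ e i) + C'.map Polynomial.C)).roots.toFinset.filter
        (fun s => 0 < s)).card ≤ m / 2 :=
  (card_posRoots_vertexGauge_le a ha e he C' hC').trans (card_negEigen_le_half hC' hpar)


/-! ## 5. The same law in the cell's R2114 currency: constant links, diagonal exponents ≥ 1 -/

/-- **R2114 CURRENCY: constant links and growing diagonal ⇒ `Z ≤ ⌊m/2⌋` (all `m`).**  A static definite tridiagonal design `(c, e)`
(`c`, `e` symmetric, `c = 0` off the band, `0 < c i i`) whose LINK EXPONENTS VANISH (`e i j = 0` for `i ≠ j`) and whose diagonal exponents are all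
`≥ 1` has at most `⌊m/2⌋` distinct positive determinant zeros: its matrix is `diagonal (c_ii X^{e_ii}) + C'` with `C'` the constant hollow
tridiagonal matrix of links, and `card_posRoots_vertexGauge_le_half` applies.  (Every design is congruent by a diagonal monomial matrix to one with
constant links — the vertex gauge; the hypothesis here is that the resulting diagonal rates are positive integers.  One-signed sector; sharp.) -/
theorem card_posRoots_constLinks_le_half {m : ℕ} (c : Fin m → Fin m → ℝ) (e : Fin m → Fin m → ℕ) (hc : ∀ i j, c i j = c j i)
    (hband : ∀ i j : Fin m, (i : ℕ) + 1 < j ∨ (j : ℕ) + 1 < i → c i j = 0) (hdiag : ∀ i, 0 < c i i)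
    (hlink : ∀ i j : Fin m, i ≠ j → e i j = 0) (hdeg : ∀ i, 1 ≤ e i i) :
    ((Matrix.det (Matrix.of fun i j : Fin m => Polynomial.C (c i j) * (X : ℝ[X]) ^ e i j)).roots.toFinset.filter
        (fun t : ℝ => 0 < t)).card ≤ m / 2 := by
  -- the constant hollow link matrix
  let C' : Matrix (Fin m) (Fin m) ℝ := Matrix.of fun i j => if i = j then 0 else c i j
  have hC' : C'.IsHermitian := by
    refine Matrix.IsHermitian.ext fun i j => ?_
    simp only [C', Matrix.of_apply, star_trivial]
    by_cases hij : i = j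
    · subst hij; simp
    · rw [if_neg (Ne.symm hij), if_neg hij, hc]
  have hpar : ∀ i j : Fin m, Even ((i : ℕ) + j) → C' i j = 0 := by
    intro i j hij
    simp only [C', Matrix.of_apply]
    by_cases h : i = j
    · rw [if_pos h]
    · rw [if_neg h]
      refine hband i j ?_
      have hne : (i : ℕ) ≠ j := fun h' => h (Fin.ext h')
      obtain ⟨r, hr⟩ := hij
      omega
  have hM : (Matrix.of fun i j : Fin m => Polynomial.C (c i j) * (X : ℝ[X]) ^ e i j)
      = Matrix.diagonal (fun i => Polynomial.C (c i i) * (X : ℝ[X]) ^ e i i) + C'.map Polynomial.C := by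
    ext i j
    simp only [Matrix.of_apply, Matrix.add_apply, Matrix.diagonal_apply, Matrix.map_apply, C']
    by_cases h : i = j
    · subst h; simp
    · rw [if_neg h, if_neg h, hlink i j h, pow_zero, mul_one, zero_add]
  rw [hM]
  exact card_posRoots_vertexGauge_le_half (fun i => c i i) hdiag (fun i => e i i) hdeg C' hC' hpar


/-! ## 6. The census currency: pencils `S₀ + Σₗ X^{dₗ} Sₗ` with positive semidefinite letters (Cameron–Psarrakos α = 1, inertia constant) -/

omit [DecidableEq ι] in
/-- the quadratic form of a sum of scaled matrices. [folklore] -/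
theorem dotProduct_sum_smul_mulVec {κ : Type} [Fintype κ] (S : κ → Matrix ι ι ℝ) (c : κ → ℝ) (x : ι → ℝ) :
    x ⬝ᵥ ((∑ l, c l • S l) *ᵥ x) = ∑ l, c l * (x ⬝ᵥ (S l *ᵥ x)) := by
  rw [Matrix.sum_mulVec, dotProduct_sum]
  refine Finset.sum_congr rfl fun l _ => ?_
  rw [Matrix.smul_mulVec, dotProduct_smul, smul_eq_mul]

omit [DecidableEq ι] in
/-- a positive combination of positive semidefinite letters whose plain sum is positive definite is positive definite. [folklore] -/
theorem posDef_sum_smul {κ : Type} [Fintype κ] (S : κ → Matrix ι ι ℝ) (hS : ∀ l, (S l).PosSemidef)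
    (hT : (∑ l, S l).PosDef) (c : κ → ℝ) (hc : ∀ l, 0 < c l) : (∑ l, c l • S l).PosDef := by
  have hH : (∑ l, c l • S l).IsHermitian := by
    unfold Matrix.IsHermitian
    rw [Matrix.conjTranspose_sum]
    exact Finset.sum_congr rfl fun l _ => by rw [Matrix.conjTranspose_smul, star_trivial, (hS l).1.eq]
  refine Matrix.PosDef.of_dotProduct_mulVec_pos hH fun x hx => ?_
  rw [star_trivial, dotProduct_sum_smul_mulVec]
  have hnn : ∀ l, 0 ≤ x ⬝ᵥ (S l *ᵥ x) := fun l => by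
    simpa only [star_trivial] using (hS l).dotProduct_mulVec_nonneg x
  have hTx : 0 < ∑ l, x ⬝ᵥ (S l *ᵥ x) := by
    have h := hT.dotProduct_mulVec_pos hx
    rwa [star_trivial, Matrix.sum_mulVec, dotProduct_sum] at h
  obtain ⟨l₀, -, hl₀⟩ : ∃ l ∈ (univ : Finset κ), 0 < x ⬝ᵥ (S l *ᵥ x) := by
    by_contra hne
    push Not at hne
    exact absurd (Finset.sum_nonpos hne) (not_le.mpr hTx)
  exact Finset.sum_pos' (fun l _ => mul_nonneg (hc l).le (hnn l)) ⟨l₀, Finset.mem_univ _, mul_pos (hc l₀) hl₀⟩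

/-- evaluation of the pencil `S₀ + Σₗ X^{dₗ} Sₗ` at a real point. [folklore] -/
theorem eval_det_psdPencil {κ : Type} [Fintype κ] (S₀ : Matrix ι ι ℝ) (d : κ → ℕ) (S : κ → Matrix ι ι ℝ) (t : ℝ) :
    (Matrix.det (S₀.map Polynomial.C + ∑ l, ((X : ℝ[X]) ^ d l) • (S l).map Polynomial.C)).eval t
      = Matrix.det (S₀ + ∑ l, t ^ d l • S l) := by
  have h := RingHom.map_det (Polynomial.evalRingHom t) (S₀.map Polynomial.C + ∑ l, ((X : ℝ[X]) ^ d l) • (S l).map Polynomial.C)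
  rw [Polynomial.coe_evalRingHom] at h
  rw [h]
  congr 1
  ext i j
  simp only [RingHom.mapMatrix_apply, Matrix.map_apply, Matrix.add_apply, Matrix.smul_apply, Matrix.sum_apply, smul_eq_mul,
    Polynomial.coe_evalRingHom, Polynomial.eval_add, Polynomial.eval_finsetSum, Polynomial.eval_mul, Polynomial.eval_pow,
    Polynomial.eval_X, Polynomial.eval_C]

/-- **INERTIA LAW IN THE CENSUS CURRENCY (Cameron–Psarrakos α = 1 with the inertia constant).**  Let `F = S₀ + Σₗ X^{dₗ} Sₗ` be a real
symmetric pencil with `Sₗ ⪰ 0`, `dₗ ≥ 1` for all `l` and `Σₗ Sₗ ≻ 0` (strictly increasing along `(0,∞)`).  Then `det F` has at most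
`#{k : λ↓ₖ(S₀) < 0} = ν₋(S₀)` distinct positive roots — the Loewner engine's `card ι` [CameronPsarrakos2019, Lemma 6: `z₊ ≤ n` for one sign
alternation] replaced by the negative inertia of the constant term. [folklore] -/
theorem card_posRoots_psdPencil_le {κ : Type} [Fintype κ] (S₀ : Matrix ι ι ℝ) (hS₀ : S₀.IsHermitian) (d : κ → ℕ) (hd : ∀ l, 1 ≤ d l)
    (S : κ → Matrix ι ι ℝ) (hS : ∀ l, (S l).PosSemidef) (hT : (∑ l, S l).PosDef) :
    ((Matrix.det (S₀.map Polynomial.C + ∑ l, ((X : ℝ[X]) ^ d l) • (S l).map Polynomial.C)).roots.toFinset.filter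
        (fun t => 0 < t)).card ≤ (univ.filter (fun k => hS₀.eigenvalues₀ k < 0)).card := by
  let G : ℝ → Matrix ι ι ℝ := fun t => S₀ + ∑ l, t ^ d l • S l
  have hG : ∀ t, (G t).IsHermitian := by
    intro t
    refine hS₀.add ?_
    unfold Matrix.IsHermitian
    rw [Matrix.conjTranspose_sum]
    exact Finset.sum_congr rfl fun l _ => by rw [Matrix.conjTranspose_smul, star_trivial, (hS l).1.eq]
  have hstrict : ∀ s t : ℝ, 0 < s → s < t → (G t - G s).PosDef := by
    intro s t hs hst
    have hsub : G t - G s = ∑ l, (t ^ d l - s ^ d l) • S l := by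
      simp only [G, add_sub_add_left_eq_sub, ← Finset.sum_sub_distrib, ← sub_smul]
    rw [hsub]
    refine posDef_sum_smul S hS hT _ fun l => sub_pos.mpr ?_
    exact pow_lt_pow_left₀ hst hs.le (Nat.one_le_iff_ne_zero.mp (hd l))
  have habove : ∀ t : ℝ, 0 < t → (G t - S₀).PosDef := by
    intro t ht
    have hsub : G t - S₀ = ∑ l, t ^ d l • S l := by simp only [G, add_sub_cancel_left]
    rw [hsub]
    exact posDef_sum_smul S hS hT _ fun l => pow_pos ht _
  refine card_posRoots_le_card_negEigen G hG hstrict hS₀ habove _ fun t ht hroot => ?_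
  rw [Polynomial.IsRoot.def, eval_det_psdPencil] at hroot
  exact hroot


end MonotoneInertia

end Summit.ValiantsHypothesis.ValiantsHypothesis.Theorems.KPlusLogSqLaw
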